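import Summits.AnomalousDissipation.AnomalousDissipation.Theorems.LawWindowMeasurability
import Summits.AnomalousDissipation.AnomalousDissipation.Theses.LionsToll
import Literature.Analysis.FluidPDE.LerayHopfProofs
import Literature.Analysis.FluidPDE.LerayHopfMomentum
import Literature.Analysis.FluidPDE.LerayHopfTimeSliceTorus
import Literature.Analysis.FluidPDE.DuchonRobertInviscidLimit
import Literature.Analysis.FluidPDE.DuchonRobertLionsEnergyEqualityGeneral
import Mathlib.MeasureTheory.Measure.SeparableMeasure
import Mathlib.MeasureTheory.Function.ConvergenceInMeasure
import HarnessLib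

/-!
# `LionsToll.MeanEnergyEqualityL4` (item stmt-AnomalousDissipation-27997) holds

The crux `Summit.AnomalousDissipation.AnomalousDissipation.Theses.LionsToll.MeanEnergyEqualityL4`
(route `LionsToll`, rank 4, «first prover target»): at every FIXED `ν > 0` and smooth steady force `f`,
every stationary Leray–Hopf trajectory law (`Torus.IsStationaryLerayHopfLaw ν f P S traj`) with finite
slice second moment `∫⁻ ofReal ‖traj ω 0‖₂² dP ≠ ∞` and finite mean unit-window `L⁴` functional
`∫⁻ (∫⁻_{(0,1)} ∫⁻ ‖traj ω s x‖ₑ⁴) dP ≠ ∞` satisfies the MEAN ENERGY EQUALITY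
`ofReal (E_P ∫₀¹ ∫ ⟪f, traj ω s⟫) ≤ ofReal ν · ∫⁻ (∫⁻_{(0,1)} ‖∇ traj ω‖₂²) dP`
(the reverse inequality is the mean Leray energy inequality; «=» in fact, see the proof).

Proof.
* MEASURABILITY (the item's recorded formal risk): the `L⁴` window functional is a measurable function
  of `ω` (`LawRealisation.measurable_windowL4`). The slice `traj ω (t ∨ 0)`, viewed in the
  second-countable space `L²(𝕋³; ℝ³)` (`MeasureTheory.Lp.SecondCountableTopology`), has measurable
  distances to every point — `‖u - a‖₂² = ‖u‖₂² - 2⟪u, a⟫ + ‖a‖₂²` is built from pairings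
  (`IsStationaryLerayHopfLaw.measurable_pairing`, `LawRealisation.measurable_pairing_clamp`) and the slice
  energy (`LawRealisation.measurable_ofReal_normSq_clamp`, Parseval) — so every functional with open
  superlevel sets pulls back measurably (`measurable_comp_of_dist`: open sets of a second-countable metric
  space are countable unions of balls); and `v ↦ ∫⁻ ‖v‖ₑⁿ` is lower semicontinuous on `L²`
  (`isClosed_setOf_lintegral_enorm_pow_le`: an `L²`-convergent sequence converges in measure, a
  subsequence converges a.e., Fatou). Joint measurability in `(t, ω)` then gives the window functional by
  Tonelli.
* PATHWISE: hence `∫₀¹ ∫ ‖u‖⁴ < ∞` for `P`-a.e. path; such a path lies in Lions' class `L⁴(0,1; L⁴)`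
  (`Torus.memLqLp_of_lintegral_lt_top`, joint measurability of a Leray–Hopf path) and the tree theorem
  `lions_energy_equality_Ioc'` (Lions 1960 / Shinbrot 1974, every dimension) gives
  `½‖u(1)‖² + ν ∫⁻_{(0,1)} ‖∇u‖₂² = ½‖u(0)‖² + ∫₀¹ ∫ ⟪f, u⟫` (`lhPath_energyEq_one_of_L4`).
* BOOKKEEPING: integrate over `P`. `‖traj ω 1‖₂² = ‖traj (S ω) 0‖₂²` (`shift`) has the same mean as
  `‖traj ω 0‖₂²` (`S` preserves `P`); the dissipation term is `P`-integrable when its `lintegral` is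
  finite (else the claim is trivial); the power term is `P`-a.e. EQUAL to an integrable combination of the
  other three, so it is integrable with the right mean without any further measurability argument. Whence
  `E_P W = ν · E_P D`.

Decomposition cell `decomp-ad`, lens-3 lineage g61 (route LionsToll = lens-3 g4 EQUIV node; this closes
its leaf E₄). No instances, no notation.

[cite: Shinbrot1974, Thm. (p = r = 4)] [cite: FoiasRosaTemam2010, Def. 3.2] [folklore]
-/

open MeasureTheory Filter Topology Set Function UnitAddTorus
open scoped ENNReal NNReal RealInnerProductSpace

noncomputable section

-- `Summit.<Summit>.<Problem>` repeats the summit = sub-problem segment (D-0017); line added at landing (census g17, writer NIT l.2012)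
set_option linter.dupNamespace false

namespace Summit.AnomalousDissipation.AnomalousDissipation.Theorems

open Literature.Analysis.FunctionSpaces Literature.Analysis.FunctionSpaces.Torus
open Literature.Analysis.FluidPDE Literature.Analysis.FluidPDE.Torus

namespace LawRealisation

/-! ### Generic: measurability through a second-countable metric space; `Lⁿ` is l.s.c. on `L²` -/

section Generic

/-- **Measurability through a second-countable metric space.** If `T : Ω → β` has measurable
distance to every point of a second-countable (pseudo)metric space `β`, then `Φ ∘ T` is measurable
for every `Φ : β → ℝ≥0∞` with open superlevel sets (e.g. lower semicontinuous): an open set of `β` is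
a countable union of balls (`TopologicalSpace.isOpen_sUnion_countable`), and the preimage of a ball is
a sublevel set of a distance. [folklore] -/
theorem measurable_comp_of_dist {Ω β : Type*} [MeasurableSpace Ω] [PseudoMetricSpace β]
    [SecondCountableTopology β] {Φ : β → ℝ≥0∞} (hΦ : ∀ c, IsOpen {v | c < Φ v}) {T : Ω → β}
    (hT : ∀ a, Measurable fun ω => dist (T ω) a) : Measurable fun ω => Φ (T ω) := by
  refine measurable_of_Ioi fun c => ?_
  set U : Set β := {v | c < Φ v} with hUdef
  set S : Set (Set β) := {B | ∃ a r, B = Metric.ball a r ∧ Metric.ball a r ⊆ U} with hSdef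
  have hS : ∀ s ∈ S, IsOpen s := by
    rintro s ⟨a, r, rfl, -⟩
    exact Metric.isOpen_ball
  obtain ⟨Tc, hTc, hTS, hU⟩ := TopologicalSpace.isOpen_sUnion_countable S hS
  have hSU : ⋃₀ S = U := by
    apply subset_antisymm
    · rintro v ⟨B, ⟨a, r, rfl, hB⟩, hv⟩
      exact hB hv
    · intro v hv
      obtain ⟨r, hr, hball⟩ := Metric.isOpen_iff.1 (hΦ c) v hv
      exact ⟨Metric.ball v r, ⟨v, r, rfl, hball⟩, Metric.mem_ball_self hr⟩
  have hpre : (fun ω => Φ (T ω)) ⁻¹' Ioi c = ⋃ B ∈ Tc, T ⁻¹' B := by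
    ext ω
    simp only [mem_preimage, mem_Ioi, mem_iUnion]
    constructor
    · intro h
      have hmem : T ω ∈ ⋃₀ Tc := by
        rw [hU, hSU]
        exact h
      obtain ⟨B, hB, hωB⟩ := hmem
      exact ⟨B, hB, hωB⟩
    · rintro ⟨B, hB, hωB⟩
      have hmem : T ω ∈ ⋃₀ S := ⟨B, hTS hB, hωB⟩
      rw [hSU] at hmem
      exact hmem
  rw [hpre]
  refine MeasurableSet.biUnion hTc fun B hB => ?_
  obtain ⟨a, r, rfl, -⟩ := hTS hB
  have hball : T ⁻¹' Metric.ball a r = (fun ω => dist (T ω) a) ⁻¹' Iio r := by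
    ext ω
    simp [Metric.mem_ball]
  rw [hball]
  exact hT a measurableSet_Iio

/-- **Lower semicontinuity of `v ↦ ∫ ‖v‖ⁿ` on `L²`**: the sublevel sets
`{v ∈ L²(μ; E) : ∫⁻ ‖v x‖ₑ ^ n dμ ≤ c}` are closed (an `L²`-convergent sequence has an a.e.
convergent subsequence; Fatou). [folklore] -/
theorem isClosed_setOf_lintegral_enorm_pow_le {X : Type*} [MeasurableSpace X] {μ : Measure X}
    {E : Type*} [NormedAddCommGroup E] (n : ℕ) (c : ℝ≥0∞) :
    IsClosed {v : Lp E 2 μ | ∫⁻ x, ‖v x‖ₑ ^ n ∂μ ≤ c} := by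
  refine isSeqClosed_iff_isClosed.1 fun v w hv hvw => ?_
  have h1 : Tendsto (fun k => eLpNorm (⇑(v k) - ⇑w) 2 μ) atTop (𝓝 0) :=
    (Lp.tendsto_Lp_iff_tendsto_eLpNorm' v w).1 hvw
  have h2 : TendstoInMeasure μ (fun k => (⇑(v k) : X → E)) atTop (⇑w) :=
    tendstoInMeasure_of_tendsto_eLpNorm (by norm_num) (fun k => (Lp.aestronglyMeasurable _))
      (Lp.aestronglyMeasurable _) h1
  obtain ⟨ns, -, hae⟩ := h2.exists_seq_tendsto_ae
  show ∫⁻ x, ‖w x‖ₑ ^ n ∂μ ≤ c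
  have hlim : ∀ᵐ x ∂μ, Tendsto (fun i => ‖v (ns i) x‖ₑ ^ n) atTop (𝓝 (‖w x‖ₑ ^ n)) := by
    filter_upwards [hae] with x hx
    exact ((ENNReal.continuous_pow n).tendsto _).comp hx.enorm
  calc ∫⁻ x, ‖w x‖ₑ ^ n ∂μ = ∫⁻ x, liminf (fun i => ‖v (ns i) x‖ₑ ^ n) atTop ∂μ := by
        refine lintegral_congr_ae ?_
        filter_upwards [hlim] with x hx
        exact hx.liminf_eq.symm
    _ ≤ liminf (fun i => ∫⁻ x, ‖v (ns i) x‖ₑ ^ n ∂μ) atTop :=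
        lintegral_liminf_le' fun i => ((Lp.aestronglyMeasurable _).enorm.pow_const _)
    _ ≤ c := liminf_le_of_frequently_le' (Frequently.of_forall fun i => hv (ns i))

/-- The superlevel sets of `v ↦ ∫⁻ ‖v x‖ₑ ^ n` on `L²` are open. [folklore] -/
theorem isOpen_setOf_lt_lintegral_enorm_pow {X : Type*} [MeasurableSpace X] {μ : Measure X}
    {E : Type*} [NormedAddCommGroup E] (n : ℕ) (c : ℝ≥0∞) :
    IsOpen {v : Lp E 2 μ | c < ∫⁻ x, ‖v x‖ₑ ^ n ∂μ} := by
  have h : {v : Lp E 2 μ | c < ∫⁻ x, ‖v x‖ₑ ^ n ∂μ} = {v : Lp E 2 μ | ∫⁻ x, ‖v x‖ₑ ^ n ∂μ ≤ c}ᶜ := by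
    ext v
    simp [not_le]
  rw [h]
  exact (isClosed_setOf_lintegral_enorm_pow_le n c).isOpen_compl

end Generic

/-! ### The `L⁴` window functional of a stationary Leray–Hopf law is measurable -/

section LawL4

variable {ν : ℝ} {f : UnitAddTorus (Fin 3) → EuclideanSpace ℝ (Fin 3)} {Ω : Type*} [MeasurableSpace Ω]
  {P : Measure Ω} {S : Ω → Ω} {traj : Ω → ℝ → UnitAddTorus (Fin 3) → EuclideanSpace ℝ (Fin 3)}

/-- The clamped slice energy `(t, ω) ↦ ‖traj ω (t ∨ 0)‖₂²` is measurable (real form). [folklore] -/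
theorem measurable_normSq_clamp (h : Torus.IsStationaryLerayHopfLaw ν f P S traj) :
    Measurable fun p : ℝ × Ω => ∫ x, ‖traj p.2 (max p.1 0) x‖ ^ 2 := by
  have h2 : (fun p : ℝ × Ω => ∫ x, ‖traj p.2 (max p.1 0) x‖ ^ 2) =
      fun p => (ENNReal.ofReal (∫ x, ‖traj p.2 (max p.1 0) x‖ ^ 2)).toReal :=
    funext fun p => (ENNReal.toReal_ofReal (integral_nonneg fun x => by positivity)).symm
  rw [h2]
  exact (measurable_ofReal_normSq_clamp h).ennreal_toReal

/-- For `a ∈ L²`, the squared `L²` distance `(t, ω) ↦ ‖traj ω (t ∨ 0) - a‖₂²` is measurable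
(`‖u - a‖² = ‖u‖² - 2⟪u, a⟫ + ‖a‖²`, pairings measurable). [folklore] -/
theorem measurable_integral_normSq_sub_clamp (h : Torus.IsStationaryLerayHopfLaw ν f P S traj)
    {a : UnitAddTorus (Fin 3) → EuclideanSpace ℝ (Fin 3)} (ha : MemLp a 2 volume) :
    Measurable fun p : ℝ × Ω => ∫ x, ‖traj p.2 (max p.1 0) x - a x‖ ^ 2 := by
  have heq : (fun p : ℝ × Ω => ∫ x, ‖traj p.2 (max p.1 0) x - a x‖ ^ 2) = fun p =>
      (∫ x, ‖traj p.2 (max p.1 0) x‖ ^ 2) - 2 * (∫ x, ⟪traj p.2 (max p.1 0) x, a x⟫) +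
        ∫ x, ‖a x‖ ^ 2 := by
    funext p
    have hu := (h.isGlobalLerayHopf p.2).memLp_two (le_max_right p.1 0)
    have i1 : Integrable (fun x => ‖traj p.2 (max p.1 0) x‖ ^ 2) volume :=
      (memLp_two_iff_integrable_sq_norm hu.1).1 hu
    have i3 : Integrable (fun x => ‖a x‖ ^ 2) volume := (memLp_two_iff_integrable_sq_norm ha.1).1 ha
    have i2 : Integrable (fun x => ⟪traj p.2 (max p.1 0) x, a x⟫) volume :=
      integrable_inner_of_memLp_two hu ha
    have hpt : (fun x => ‖traj p.2 (max p.1 0) x - a x‖ ^ 2) =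
        fun x => (‖traj p.2 (max p.1 0) x‖ ^ 2 - 2 * ⟪traj p.2 (max p.1 0) x, a x⟫) + ‖a x‖ ^ 2 := by
      funext x
      rw [norm_sub_sq_real]
    have i12 : Integrable (fun x => ‖traj p.2 (max p.1 0) x‖ ^ 2 - 2 * ⟪traj p.2 (max p.1 0) x, a x⟫)
        volume := i1.sub (i2.const_mul 2)
    rw [hpt, integral_add i12 i3, integral_sub i1 (i2.const_mul 2), integral_const_mul]
  rw [heq]
  exact ((measurable_normSq_clamp h).sub ((measurable_pairing_clamp h ha).const_mul 2)).add_const _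

/-- The `L²` distance from the clamped slice, viewed in `L²(𝕋³; ℝ³)`, to a fixed element `a ∈ L²`
is a measurable function of `(t, ω)`. [folklore] -/
theorem measurable_dist_toLp_clamp (h : Torus.IsStationaryLerayHopfLaw ν f P S traj)
    (a : Lp (EuclideanSpace ℝ (Fin 3)) 2 (volume : Measure (UnitAddTorus (Fin 3)))) :
    Measurable fun p : ℝ × Ω =>
      dist (((h.isGlobalLerayHopf p.2).memLp_two (le_max_right p.1 0)).toLp (traj p.2 (max p.1 0))) a := by
  have ha : MemLp (a : UnitAddTorus (Fin 3) → EuclideanSpace ℝ (Fin 3)) 2 volume := Lp.memLp a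
  have heq : (fun p : ℝ × Ω =>
      dist (((h.isGlobalLerayHopf p.2).memLp_two (le_max_right p.1 0)).toLp (traj p.2 (max p.1 0))) a) =
      fun p => ((ENNReal.ofReal (∫ x, ‖traj p.2 (max p.1 0) x - a x‖ ^ 2)) ^ (1 / 2 : ℝ)).toReal := by
    funext p
    have hu := (h.isGlobalLerayHopf p.2).memLp_two (le_max_right p.1 0)
    rw [Lp.dist_def]
    have hae : (⇑(hu.toLp (traj p.2 (max p.1 0))) : UnitAddTorus (Fin 3) → EuclideanSpace ℝ (Fin 3)) - ⇑a
        =ᵐ[volume] traj p.2 (max p.1 0) - ⇑a :=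
      hu.coeFn_toLp.sub EventuallyEq.rfl
    rw [eLpNorm_congr_ae hae, eLpNorm_eq_lintegral_rpow_enorm_toReal two_ne_zero ENNReal.ofNat_ne_top]
    have hsub : MemLp (traj p.2 (max p.1 0) - ⇑a) 2 volume := hu.sub ha
    have h2 : ∫⁻ x, ‖(traj p.2 (max p.1 0) - ⇑a) x‖ₑ ^ (2 : ℝ≥0∞).toReal =
        ENNReal.ofReal (∫ x, ‖traj p.2 (max p.1 0) x - a x‖ ^ 2) := by
      rw [ENNReal.toReal_ofNat]
      have hr : (fun x => ‖(traj p.2 (max p.1 0) - ⇑a) x‖ₑ ^ (2 : ℝ)) =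
          fun x => ‖(traj p.2 (max p.1 0) - ⇑a) x‖ₑ ^ 2 := by
        funext x
        exact ENNReal.rpow_ofNat _ 2
      rw [hr, Torus.lintegral_enorm_sq_eq_ofReal hsub]
      simp only [Pi.sub_apply]
    rw [h2, ENNReal.toReal_ofNat]
  rw [heq]
  exact ((measurable_integral_normSq_sub_clamp h ha).ennreal_ofReal.pow_const _).ennreal_toReal

/-- **Joint measurability of the `Lⁿ`-type slice functionals.** For every `n`,
`(t, ω) ↦ ∫⁻ ‖traj ω (t ∨ 0) x‖ₑ ^ n dx` is measurable on `ℝ × Ω`: the slice, as an element of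
the second-countable space `L²(𝕋³; ℝ³)`, is a measurable function of `(t, ω)` (its distances to
all points are), and `v ↦ ∫⁻ ‖v‖ₑ ^ n` is lower semicontinuous on `L²`. [folklore] -/
theorem measurable_lintegral_enorm_pow_clamp (h : Torus.IsStationaryLerayHopfLaw ν f P S traj)
    (n : ℕ) : Measurable fun p : ℝ × Ω => ∫⁻ x, ‖traj p.2 (max p.1 0) x‖ₑ ^ n := by
  haveI : Fact ((2 : ℝ≥0∞) ≠ ⊤) := ⟨ENNReal.ofNat_ne_top⟩
  haveI : SecondCountableTopology
      (Lp (EuclideanSpace ℝ (Fin 3)) 2 (volume : Measure (UnitAddTorus (Fin 3)))) :=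
    Lp.SecondCountableTopology
  have hΦT : Measurable fun p : ℝ × Ω => ∫⁻ x,
      ‖(((h.isGlobalLerayHopf p.2).memLp_two (le_max_right p.1 0)).toLp (traj p.2 (max p.1 0))) x‖ₑ ^ n :=
    measurable_comp_of_dist
      (Φ := fun v : Lp (EuclideanSpace ℝ (Fin 3)) 2 (volume : Measure (UnitAddTorus (Fin 3))) =>
        ∫⁻ x, ‖v x‖ₑ ^ n)
      (isOpen_setOf_lt_lintegral_enorm_pow n) (measurable_dist_toLp_clamp h)
  have heq : (fun p : ℝ × Ω => ∫⁻ x,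
      ‖(((h.isGlobalLerayHopf p.2).memLp_two (le_max_right p.1 0)).toLp (traj p.2 (max p.1 0))) x‖ₑ ^ n) =
      fun p : ℝ × Ω => ∫⁻ x, ‖traj p.2 (max p.1 0) x‖ₑ ^ n := by
    funext p
    refine lintegral_congr_ae ?_
    filter_upwards [((h.isGlobalLerayHopf p.2).memLp_two (le_max_right p.1 0)).coeFn_toLp] with x hx
    rw [hx]
  rw [← heq]
  exact hΦT

/-- **The `L⁴` unit-window functional of a stationary Leray–Hopf law is measurable**:
`ω ↦ ∫⁻_{(0,1)} ∫⁻ ‖traj ω s x‖ₑ⁴ dx ds` is a measurable function of `ω` (Tonelli). [folklore] -/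
theorem measurable_windowL4 (h : Torus.IsStationaryLerayHopfLaw ν f P S traj) :
    Measurable fun ω => ∫⁻ s in Ioo (0 : ℝ) 1, ∫⁻ x, ‖traj ω s x‖ₑ ^ 4 := by
  have heq : (fun ω => ∫⁻ s in Ioo (0 : ℝ) 1, ∫⁻ x, ‖traj ω s x‖ₑ ^ 4) =
      fun ω => ∫⁻ s in Ioo (0 : ℝ) 1, ∫⁻ x, ‖traj ω (max s 0) x‖ₑ ^ 4 := by
    funext ω
    exact setLIntegral_congr_fun measurableSet_Ioo fun s hs => by rw [max_eq_left hs.1.le]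
  rw [heq]
  exact (measurable_lintegral_enorm_pow_clamp h 4).lintegral_prod_left'

end LawL4

/-! ### Pathwise: Lions' energy equality on the unit window under `∫₀¹ ‖u‖₄⁴ < ∞` -/

section PathL4

variable {ν : ℝ} {f : UnitAddTorus (Fin 3) → EuclideanSpace ℝ (Fin 3)}
  {u : ℝ → UnitAddTorus (Fin 3) → EuclideanSpace ℝ (Fin 3)}

/-- A steady `L²` force lies in the guarded mixed class `L¹(0,T; L²)` (adapted from
`Literature.Barriers.AnomalousDissipation.SingleShellEnstrophyBound.memLqLp_one_two_steady`). [folklore] -/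
theorem memLqLp_one_two_steady' {F : UnitAddTorus (Fin 3) → EuclideanSpace ℝ (Fin 3)}
    (hF : MemLp F 2 volume) (T : ℝ) : Torus.MemLqLp 1 2 (fun _ : ℝ => F) (Ioo 0 T) := by
  haveI : IsFiniteMeasure (volume.restrict (Ioo (0 : ℝ) T)) :=
    ⟨by rw [Measure.restrict_apply_univ]; exact measure_Ioo_lt_top⟩
  exact ⟨ae_of_all _ fun _ => hF, (memLp_const (eLpNorm F 2 volume).toReal).2⟩

/-- **Pathwise Lions energy equality on the unit window.** A global Leray–Hopf solution of
`NS_ν(f)` (steady smooth force) issued from its own slice `u 0`, with `∫₀¹ ∫ ‖u‖⁴ < ∞`, lies in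
Lions' class `L⁴(0,1; L⁴)` (Tonelli) and hence satisfies the energy EQUALITY at time `1`:
`½‖u(1)‖² + ν ∫⁻_{(0,1)} ‖∇u‖₂² = ½‖u(0)‖² + ∫₀¹ ∫ ⟪f, u⟫`
(`Literature.Analysis.FluidPDE.lions_energy_equality_Ioc'`, Lions 1960 / Shinbrot 1974).
[cite: Shinbrot1974, Thm. (p = r = 4)] -/
theorem lhPath_energyEq_one_of_L4 (hu : Torus.IsGlobalLerayHopf ν (fun _ => f) (u 0) u)
    (hf : IsSmooth f) (h4 : ∫⁻ s in Ioo (0 : ℝ) 1, ∫⁻ x, ‖u s x‖ₑ ^ 4 < ⊤) :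
    kineticEnergy (u 1) + ν * (∫⁻ s in Ioo (0 : ℝ) 1, eGradNormSq (u s)).toReal =
      kineticEnergy (u 0) + ∫ s in (0 : ℝ)..1, ∫ x, ⟪f x, u s x⟫ := by
  have hLH := hu 1 one_pos
  have h4' : ∫⁻ s in Ioo (0 : ℝ) 1, ∫⁻ x, ‖u s x‖ₑ ^ (4 : ℝ≥0∞).toReal < ⊤ := by
    have hr : (fun s => ∫⁻ x, ‖u s x‖ₑ ^ (4 : ℝ≥0∞).toReal) = fun s => ∫⁻ x, ‖u s x‖ₑ ^ 4 := by
      funext s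
      refine lintegral_congr_ae (ae_of_all _ fun x => ?_)
      rw [ENNReal.toReal_ofNat]
      exact ENNReal.rpow_ofNat _ 4
    rw [hr]
    exact h4
  have hu4 : Torus.MemLqLp 4 4 u (Ioo 0 1) :=
    Torus.memLqLp_of_lintegral_lt_top (by norm_num) (by norm_num) hLH.aestronglyMeasurable_uncurry h4'
  exact lions_energy_equality_Ioc' hLH (hu.memLp_two le_rfl) hu4
    (Torus.aestronglyMeasurable_stLift_steady hf.continuous.aestronglyMeasurable _)
    (memLqLp_one_two_steady' (hf.memLp 2) 1) 1 ⟨one_pos, le_rfl⟩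

end PathL4

end LawRealisation

/-! ### The crux `LionsToll.MeanEnergyEqualityL4` -/

open LawRealisation in
/-- **`LionsToll.MeanEnergyEqualityL4` (crux, rank 4) holds.** For a stationary Leray–Hopf
trajectory law of `NS_ν(f)` on `𝕋³` (fixed `ν > 0`, steady smooth force) with finite mean slice
energy and `P`-integrable unit-window `L⁴` functional `∫₀¹‖u‖₄⁴`, the MEAN energy EQUALITY holds:
`E_P ∫₀¹∫⟪f, u⟫ = ν E_P ∫⁻_{(0,1)} ‖∇u‖₂²` (stated as `≤` in `ℝ≥0∞`). Proof: the `L⁴` window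
functional is a measurable function of `ω` (`measurable_windowL4`: the slice is a Borel map into
the second-countable space `L²(𝕋³)` because its distances to all points are measurable pairings,
and `v ↦ ∫‖v‖⁴` is lower semicontinuous on `L²`), so it is finite `P`-a.s.; on that event the path
lies in Lions' class on `(0, 1)` and satisfies the pathwise energy equality at time `1`
(`lhPath_energyEq_one_of_L4`); integrating over `P`, the slice energies at times `1` and `0` have
the same mean by stationarity (`traj ω 1 = traj (S ω) 0`, `S` measure preserving), whence
`E W = ν E D`. If `E D = ∞` the inequality is trivial. [cite: Shinbrot1974, Thm. (p = r = 4)] -/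
theorem lionsToll_meanEnergyEqualityL4 :
    Summit.AnomalousDissipation.AnomalousDissipation.Theses.LionsToll.MeanEnergyEqualityL4 := by
  intro ν hν f hf _hdiv _hmean Ω _ P S traj hlaw h2 h4
  haveI := hlaw.isProbabilityMeasure
  by_cases hDtop : (∫⁻ ω, (∫⁻ s in Ioo (0 : ℝ) 1, eGradNormSq (traj ω s)) ∂P) = ⊤
  · rw [hDtop, ENNReal.mul_top (ENNReal.ofReal_pos.2 hν).ne']
    exact le_top
  -- the three measurable random variables
  have hX0m : Measurable fun ω => ∫ x, ‖traj ω 0 x‖ ^ 2 := measurable_normSq_zero hlaw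
  have hDm : Measurable fun ω => ∫⁻ s in Ioo (0 : ℝ) 1, eGradNormSq (traj ω s) :=
    measurable_lintegral_eGradNormSq hlaw
  have hL4m : Measurable fun ω => ∫⁻ s in Ioo (0 : ℝ) 1, ∫⁻ x, ‖traj ω s x‖ₑ ^ 4 :=
    measurable_windowL4 hlaw
  -- slice energy at time 0: integrable
  have hX0i : Integrable (fun ω => ∫ x, ‖traj ω 0 x‖ ^ 2) P := by
    refine ⟨hX0m.aestronglyMeasurable, ?_⟩
    rw [hasFiniteIntegral_iff_ofReal (ae_of_all _ fun ω => integral_nonneg fun x => by positivity)]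
    exact lt_top_iff_ne_top.2 h2
  -- slice energy at time 1 = slice energy at time 0 along `S`; same mean (stationarity)
  have hshift : ∀ ω, traj ω 1 = traj (S ω) 0 := fun ω => by rw [hlaw.shift ω 0, zero_add]
  have hX1i : Integrable (fun ω => ∫ x, ‖traj (S ω) 0 x‖ ^ 2) P :=
    (hlaw.measurePreserving.integrable_comp hX0i.aestronglyMeasurable).2 hX0i
  have hX1int : ∫ ω, (∫ x, ‖traj (S ω) 0 x‖ ^ 2) ∂P = ∫ ω, (∫ x, ‖traj ω 0 x‖ ^ 2) ∂P := by
    have hmap := integral_map (μ := P) hlaw.measurePreserving.measurable.aemeasurable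
      (f := fun ω => ∫ x, ‖traj ω 0 x‖ ^ 2)
      (by rw [hlaw.measurePreserving.map_eq]; exact hX0m.aestronglyMeasurable)
    rw [hlaw.measurePreserving.map_eq] at hmap
    exact hmap.symm
  -- the window dissipation: integrable with the right mean (finite case)
  have hDi : Integrable (fun ω => (∫⁻ s in Ioo (0 : ℝ) 1, eGradNormSq (traj ω s)).toReal) P :=
    integrable_toReal_of_lintegral_ne_top hDm.aemeasurable hDtop
  have hDint : ∫ ω, (∫⁻ s in Ioo (0 : ℝ) 1, eGradNormSq (traj ω s)).toReal ∂P =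
      (∫⁻ ω, (∫⁻ s in Ioo (0 : ℝ) 1, eGradNormSq (traj ω s)) ∂P).toReal :=
    integral_toReal hDm.aemeasurable (ae_lt_top hDm hDtop)
  -- the pathwise energy equality, `P`-almost surely (Lions' class a.s. by Tonelli + measurability)
  have hae : ∀ᵐ ω ∂P, (∫ s in (0 : ℝ)..1, ∫ x, ⟪f x, traj ω s x⟫) =
      2⁻¹ * (∫ x, ‖traj (S ω) 0 x‖ ^ 2) + ν * (∫⁻ s in Ioo (0 : ℝ) 1, eGradNormSq (traj ω s)).toReal -
        2⁻¹ * ∫ x, ‖traj ω 0 x‖ ^ 2 := by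
    filter_upwards [ae_lt_top hL4m h4] with ω hω
    have hid := lhPath_energyEq_one_of_L4 (hlaw.isGlobalLerayHopf ω) hf hω
    rw [hshift ω] at hid
    simp only [kineticEnergy] at hid
    linarith
  -- integrate over `P`
  have hWint : ∫ ω, (∫ s in (0 : ℝ)..1, ∫ x, ⟪f x, traj ω s x⟫) ∂P =
      ν * (∫⁻ ω, (∫⁻ s in Ioo (0 : ℝ) 1, eGradNormSq (traj ω s)) ∂P).toReal := by
    have hI1 : Integrable (fun ω => 2⁻¹ * (∫ x, ‖traj (S ω) 0 x‖ ^ 2) +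
        ν * (∫⁻ s in Ioo (0 : ℝ) 1, eGradNormSq (traj ω s)).toReal) P :=
      (hX1i.const_mul _).add (hDi.const_mul _)
    rw [integral_congr_ae hae, integral_sub hI1 (hX0i.const_mul _),
      integral_add (hX1i.const_mul _) (hDi.const_mul _), integral_const_mul, integral_const_mul,
      integral_const_mul, hX1int, hDint]
    ring
  rw [hWint, ENNReal.ofReal_mul hν.le, ENNReal.ofReal_toReal hDtop]

end Summit.AnomalousDissipation.AnomalousDissipation.Theorems

end
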